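import Summits.AnomalousDissipation.AnomalousDissipation.Theorems.NeutralTaylorWavesNonresonantSelectionLinearisedEnergyIneq
import Summits.AnomalousDissipation.AnomalousDissipation.Theorems.NeutralTaylorWavesNonresonantSelectionResidualPerturbation
import Summits.AnomalousDissipation.AnomalousDissipation.Theorems.NeutralTaylorWavesNonresonantSelectionTransferAlgebra
import HarnessLib

/-!
# Kato-type stability of polynomial bordered a-priori bounds for the linearised steady
# Navier–Stokes operator on `T³` — crux `NeutralTaylorWaves.NonresonantSelection`
# (stmt-AnomalousDissipation-16294), line `birth`

The registrar's stub `stub_borderedGapStability` of `Cruxes/NonresonantSelection/Lines/birth.lean`,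
PROVED (constants `κ = 1/16`, `A = 2`), as the composition of the three landed stubs
`stub_linearisedEnergyIneq` (energy inequality of the bordered linearised operator),
`stub_residualPerturbation` (`L²` perturbation of the bordered residual and of the border pairing) and
`stub_transferAlgebra` (the real-number endgame).

Setting. For a smooth base field `w : T³ → ℝ³` with drift `c` along `x₃` and viscosity `ν`, the
BORDERED linearised steady operator sends a test triple `(v, r, b)` (smooth divergence-free mean-zero
`v`, smooth `r`, real `b`) to `(F, g)` with
`F = w·∇v + v·∇w − νΔv + ∇r − c∂₃v − b∂₃w`, `g = ∫⟪v, ∂₃w⟫`; the bordered a-priori bound with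
constant `M` is `‖v‖₂² + b² ≤ M²(‖F‖₂² + g²)` for all test triples (the last clause of the route target
`NonresonantTaylorWaves`, with `M = C₀ν^{-K₀}`).

Theorem (`stub_borderedGapStability`, registered on the crux item under that name). If the bound holds at `(w₁, c₁)` with constant
`M ≥ 0`, `sup‖∂ᵢw‖ ≤ G`, `(w, c)` is `δ`-close to `(w₁, c₁)` (`sup‖w − w₁‖ ≤ δ`,
`sup‖∂ᵢw − ∂ᵢw₁‖ ≤ δ`, `|c − c₁| ≤ δ`) and `δ(1+M)(1+G) ≤ ν/16`, `0 < ν ≤ 1`, then the bound holds at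
`(w, c)` with constant `2(1+M)`. This is the a-priori-estimate form of Kato's stability of bounded
invertibility under a relatively bounded perturbation (Kato 1966, Thm IV.1.16): the perturbation
`(w₁−w)·∇v + v·∇(w₁−w) − (c₁−c)∂₃v − b∂₃(w₁−w)` is bounded RELATIVELY to the operator with constant
`∝ ν^{-1/2}(1+G)` through the energy inequality `ν‖∇v‖² ≤ 2XY + 3GX²`. In the line it makes the
uniformity of `(C₀, K₀)` in the order `K` automatic once all orders sit `ν^{K₀+3}`-close to one spine.
-/

-- `Summit.<Summit>.<Problem>` is the tree's mandated summit-side namespace; for this single-conjunct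
-- summit the two segments coincide, so the duplicate is deliberate.
set_option linter.dupNamespace false

noncomputable section

namespace Summit.AnomalousDissipation.AnomalousDissipation.Theorems

open MeasureTheory
open scoped InnerProductSpace
open Literature.Analysis.FunctionSpaces

/-- **Kato-type stability of polynomial bordered bounds** (registrar's `stub_borderedGapStability`,
`κ = 1/16`, `A = 2`). If the bordered a-priori bound for the steady Navier–Stokes operator linearised
at `(w₁, c₁)` holds with constant `M ≥ 0`, `sup‖∂ᵢw‖ ≤ G`, `(w, c)` is `δ`-close to `(w₁, c₁)` in
`W^{1,∞} × drift` and `δ(1+M)(1+G) ≤ ν/16` with `0 < ν ≤ 1`, then the bordered bound holds at `(w, c)`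
with constant `2(1+M)`: for every smooth divergence-free mean-zero `v`, smooth `r`, real `b`,
`‖v‖₂² + b² ≤ (2(1+M))² (‖w·∇v + v·∇w − νΔv + ∇r − c∂₃v − b∂₃w‖₂² + (∫⟪v, ∂₃w⟫)²)`.
[cite: Kato1966, Ch. IV §1.4 Thm 1.16] -/
theorem stub_borderedGapStability :
    ∀ (ν : ℝ) (w₁ w : UnitAddTorus (Fin 3) → EuclideanSpace ℝ (Fin 3)) (c₁ c M G δ : ℝ),
      0 < ν → ν ≤ 1 → 0 ≤ M → 0 ≤ G → 0 ≤ δ →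
      Torus.IsSmooth w₁ → Torus.IsSmooth w → Torus.IsDivFree w →
      (∀ (v : UnitAddTorus (Fin 3) → EuclideanSpace ℝ (Fin 3)) (r : UnitAddTorus (Fin 3) → ℝ) (b : ℝ),
        Torus.IsSmooth v → Torus.IsSmooth r → Torus.IsDivFree v → Torus.HasZeroMean v →
        (∫ x, ‖v x‖ ^ 2) + b ^ 2 ≤
          M ^ 2 * ((∫ x, ‖Torus.convect w₁ v x + Torus.convect v w₁ x - ν • Torus.laplacian v x +
              Torus.gradient r x - c₁ • Torus.partialDeriv (2 : Fin 3) v x -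
              b • Torus.partialDeriv (2 : Fin 3) w₁ x‖ ^ 2) +
            (∫ x, inner ℝ (v x) (Torus.partialDeriv (2 : Fin 3) w₁ x)) ^ 2)) →
      (∀ (i : Fin 3) x, ‖Torus.partialDeriv i w x‖ ≤ G) →
      (∀ x, ‖w x - w₁ x‖ ≤ δ) →
      (∀ (i : Fin 3) x, ‖Torus.partialDeriv i w x - Torus.partialDeriv i w₁ x‖ ≤ δ) →
      |c - c₁| ≤ δ →
      δ * (1 + M) * (1 + G) ≤ ν / 16 →
      ∀ (v : UnitAddTorus (Fin 3) → EuclideanSpace ℝ (Fin 3)) (r : UnitAddTorus (Fin 3) → ℝ) (b : ℝ),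
        Torus.IsSmooth v → Torus.IsSmooth r → Torus.IsDivFree v → Torus.HasZeroMean v →
        (∫ x, ‖v x‖ ^ 2) + b ^ 2 ≤
          (2 * (1 + M)) ^ 2 * ((∫ x, ‖Torus.convect w v x + Torus.convect v w x - ν • Torus.laplacian v x +
              Torus.gradient r x - c • Torus.partialDeriv (2 : Fin 3) v x -
              b • Torus.partialDeriv (2 : Fin 3) w x‖ ^ 2) +
            (∫ x, inner ℝ (v x) (Torus.partialDeriv (2 : Fin 3) w x)) ^ 2) := by
  intro ν w₁ w c₁ c M G δ hν hν1 hM hG hδ hw₁ hw hwdiv hgap hsupG hprox0 hprox1 hproxc hsmall v r b hv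
    hr hvdiv hvmean
  -- the six real quantities of the test triple
  set E : ℝ := ∫ x, ‖v x‖ ^ 2 with hE_def
  set P : ℝ := ∫ x, ‖Torus.convect w v x + Torus.convect v w x - ν • Torus.laplacian v x +
      Torus.gradient r x - c • Torus.partialDeriv (2 : Fin 3) v x -
      b • Torus.partialDeriv (2 : Fin 3) w x‖ ^ 2 with hP_def
  set g : ℝ := ∫ x, inner ℝ (v x) (Torus.partialDeriv (2 : Fin 3) w x) with hg_def
  set P₁ : ℝ := ∫ x, ‖Torus.convect w₁ v x + Torus.convect v w₁ x - ν • Torus.laplacian v x +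
      Torus.gradient r x - c₁ • Torus.partialDeriv (2 : Fin 3) v x -
      b • Torus.partialDeriv (2 : Fin 3) w₁ x‖ ^ 2 with hP₁_def
  set g₁ : ℝ := ∫ x, inner ℝ (v x) (Torus.partialDeriv (2 : Fin 3) w₁ x) with hg₁_def
  set D : ℝ := Torus.gradNormSq v with hD_def
  have hE0 : 0 ≤ E := integral_nonneg fun x => by positivity
  have hP0 : 0 ≤ P := integral_nonneg fun x => by positivity
  have hP₁0 : 0 ≤ P₁ := integral_nonneg fun x => by positivity
  have hD0 : 0 ≤ D := Torus.gradNormSq_nonneg v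
  -- (h1) the bound at the reference base, (h2) energy, (h3)/(h4) perturbation, then the algebra
  have h1 : E + b ^ 2 ≤ M ^ 2 * (P₁ + g₁ ^ 2) := hgap v r b hv hr hvdiv hvmean
  have h2 : ν * D ≤ Real.sqrt P * Real.sqrt E + 3 * G * E + |b| * |g| :=
    stub_linearisedEnergyIneq ν c b G w v r hw hwdiv hv hvdiv hr hsupG
  obtain ⟨h3, h4⟩ :=
    stub_residualPerturbation ν c₁ c b δ w₁ w v r hw₁ hw hv hr hδ hprox0 hprox1 hproxc
  exact stub_transferAlgebra ν M G δ E b P g P₁ g₁ D hν hν1 hM hG hδ hE0 hP0 hP₁0 hD0 hsmall h1 h2 h3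
    h4

end Summit.AnomalousDissipation.AnomalousDissipation.Theorems

end
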